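/-
Copyright: cell `langlands-arthur-audit` (papers/Langlands/langlands-arthur-audit), unit `pub-arthur-down-g44`
(downstream tracer, gen 44).  Thirty-fourth file of the downstream register (module M235 of the cell's MODULE-MAP, CLAIMed in `lean/MODULE-MAP2.md`
2026-08-23; M232 / M234 are the TYPER line's `Leaves/Sp4LogIntegral.lean` / `Leaves/Sp4QuadraticCoordinates.lean`, M233 this line's support file
`DownstreamSupport14.lean`): `Downstream.lean` (tranches 1–4) … `Downstream33.lean` (111–114, module M231, at 87 % of the gate's 200 000-byte file cap after v4) are
full or kept for small appends, so the register continues here, APPEND-ONLY in the same conventions and the same namespace `…Arthur2013.Downstream`; v1 imports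
`…Downstream33` (through it `…Downstream32`, … and `…Downstream` (`BookInputs`, `Nodes`, tranche 4's `Consumers4.BergeronClozel13` with `bergeronClozel13_of_leaves` /
`bergeronClozel13_conditional_form`) and tranche 113's `Consumers113.BLSWoperatorUnstable` with `Implications113`).  v1 = the hundred-and-fifteenth tranche (`Consumers115`:
THE HYPERBOLIC-MANIFOLDS VEIN, II — the first THIRD-ORDER consumer of row D9 (N. Bergeron – L. Clozel, Invent. Math. 192 (2013)), found among the local-graph citers of
tranche 113's four rows (GAPS G-DN-459): NEW row C300 M. Dadarlat, *Non-stable groups*, arXiv:2304.04645 (PREPRINT; `DadarlatUniformToLocal` = Corollary 1.5 ⇐ row C297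
U. Bader – A. Lubotzky – R. Sauer – S. Weinberger, J. Anal. Math. 151 (2023), Corollary 3.13 (`Consumers113.BLSWoperatorUnstable`): « Concerning lattices in SO(n, 1), the following nonvanishing result is established in [ 3]. » / « Theorem 1.4 (Cor. 3.13 of [ 3]). » /
« By Theorem 1.2, we deduce: » « Corollary 1.5. The groups Γ as in Theorem 1.4 are not uniform-to-local stable. »); `Implications115`; bookkeeping theorems); v2 (unit `pub-arthur-down-g46`, downstream tracer gen 46) = the hundred-and-sixteenth
tranche APPENDED (`Consumers116`: THE CONDUIT CITATION-INDEX SWEEP — the zbMATH Open citation index of fifty-seven conduit documents of the register matched against the census —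
NEW rows C301 S. Grushevsky – T. Ibukiyama – G. Mondello – R. Salvati Manni, *Differentiating Siegel modular forms and the moving slope of 𝒜_g*, IMRN 2024 (`GIMSMthetaPrime` =
Corollary E — the form θ_{L,h,2} on 𝒜₆ is prime — ⇐ row C6 `Consumers.ChenevierTaibi`: « In light of the classiﬁcation of modular forms in low genus and weight in [C T20] » « and [CT], in genus 6 there are no cusp forms in weight 7 , 8, 9, 11, 13. ») and C302 S. Das – H. Krishna, *Bounds for the Bergman
kernel and the sup-norm of holomorphic Siegel cusp forms*, IMRN 2024 (`DasKrishnaLindelof` = Corollary 1.7 ⇐ row C41 `Consumers67.FMBessel`: the relation (1.10) « proved by Furusawa, and »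
« Morimoto [ FM21] », « 3.3. Proof of Corollary 1.7. From (3.1) and ( 1.10), we can write after a rearrangement »); `Implications116`; bookkeeping theorems; no new import); v3 (unit `pub-arthur-down-g50`, downstream tracer gen 50) = the hundred-and-seventeenth tranche
APPENDED (`Consumers117`: NEW row C303 = the text of control E60 of `DOWNSTREAM3.md`, P. Boisseau – W. Lu – H. Xue, arXiv:2601.01738 (2026; PREPRINT; part III of the split of
arXiv:2404.07342), re-read when the OpenCitations index of the reference lists citing Mok's memoir returned it — `BLXggp` = Theorem 1.1 = 4.1, premise-free, E60's reading
(« The statement we give is independent of [Mok] and [KMSW] as it only relies on the notion of weak base-change. »); `BLXbc` = §1.3's standing hypothesis as a NODE with the text's supplier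
sentence (« If we assume that all the $\mathrm{BC}(\sigma_v)$ are generic, then by [Mok] and [KMSW], $\mathrm{BC}(\sigma)$ always exists and is a strong base-change ») ⇐ Mok at every rank ∧ KMSW's proved
scope; `BLXii` = Theorem 1.4 = 4.2, the Ichino–Ikeda-type formula ⇐ the node; `Implications117`; bookkeeping theorems in the two-readings pattern of row B7; no new import).
Nothing of the first thirty-three files is redeclared or changed.
-/
import HarnessLib
import Literature.NumberTheory.Automorphic.Arthur2013.Downstream33

/-!
# Downstream of Arthur (2013), Mok (2015), KMSW (2014): the typed register, thirty-fourth file (tranches ≥ 115)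

**What is reproduced.**  As in the first thirty-three files: for published theorems (and dated preprints) that invoke J. Arthur, *The Endoscopic Classification of
Representations* (AMS Colloq. Publ. 61, 2013) [cite: Arthur2013], C. P. Mok's memoir [cite: Mok2012] or Kaletha – Mínguez – Shin – White [claim: KalethaMinguezShinWhite2014,
under-review], or that invoke an already-typed consumer of them, one HYPOTHESIS `E_…` per statement quoting the sentences in which the paper invokes them, recording WHICH
leaves and nodes of the three dependency DAGs the proof consumes; and bookkeeping theorems composing these hypotheses with the packaged inputs `BookInputs` of
`Downstream.lean` and with the bookkeeping theorems of the rows reused (`bergeronClozel13_of_leaves` / `bergeronClozel13_conditional_form` of tranche 4; the edge structure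
`Implications113` of tranche 113).  Quotations are exact substrings of the cell's texts, staged byte-identically with sha256 under `HOME/pub-arthur-down-g44/primaries/`
(`SHA256SUMS`): the arXiv PDF text `paper-arxiv-2304.04645` (row C300: fetched 2026-08-23 = v1 2023-04-10, the only version per the arXiv API record
`primaries/arxivabs/api_2304.04645.xml`, 23 pages, pNNNN = PDF page; the PDF text layer keeps a few mid-word spaces, reproduced verbatim) and tranche 113's corpus TeX chunking
`paper-arxiv-2303.08943` (row C297, arXiv v2).  Locators ‘pNNNN:Ln’.  Bibliography entries are in `--` comments.

**Why a thirty-fourth file, and why this row (v1; GAPS G-DN-458 / G-DN-459).**  `Downstream33.lean` reached 87 % of the cap with tranche 114.  Tranche 113 opened THE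
HYPERBOLIC-MANIFOLDS VEIN — four consumers of row D9 in spectral geometry, differential topology, group stability and homogeneous dynamics (rows C295 – C298) — and this unit
then read the local-graph citers of those four texts (Magee 2015: 31; Kotschick 2023: 3; Bader – Lubotzky – Sauer – Weinberger 2023: 12; Kelmer – Yu 2019: 27): ONE of them
uses a D9-dependent statement inside a numbered result.  ROW C300 (ABSENT; PREPRINT): Marius Dadarlat, *Non-stable groups* (arXiv:2304.04645 [math.OA], v1 2023-04-10; no
journal reference or DOI in the arXiv record, none found at Semantic Scholar / zbMATH on 2026-08-23; bib Dadarlat2023NonStable NEW) — `DadarlatUniformToLocal` := Corollary 1.5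
(the cocompact lattices of SO(n,1), n odd, of BLSW's Corollary 3.13 — n = 3; n = 4m+1; n = 4m+3 and arithmetic, not of type ⁶D₄ when n = 7 — are not uniform-to-local stable)
⇐ C297, through the text's Theorem 1.4, which restates [read: Cor. 3.13 of [3]] by its cohomological content (a finite-index Λ₁ all of whose finite-index subgroups have some
even Betti number b₂ᵢ > 0) and feeds it to the author's own Theorem 1.2 (= Theorem 4.2: π₁ of a closed manifold of strictly negative curvature with residually finite
fundamental group and some b₂ᵢ ≠ 0 is not uniform-to-local stable — K-theoretic, Arthur-free): « we point out that many of the cocompact lattices in the Lorentz group SO0(n, 1),n> 1 are not uniform-to-local stable. » … « it remains to realize the condition on Betti numbers. » … « Concerning lattices in SO(n, 1), the following nonvanishing result is established in [ 3]. » … « By Theorem 1.2, we deduce: »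
« Corollary 1.5. The groups Γ as in Theorem 1.4 are not uniform-to-local stable. ».  In C297's text the arithmetic case n = 4m+3 is its Theorem 3.10, « Theorem 1.4 (Cor. 3.13 of [ 3]). » [Dadarlat] ↔ p0012:L38-39 "Proof. Immediate by Theorem (thm: main old result)(O), given Theorem (thm:SO31), Theorem (thm:BC) and Theorem (thm:nonar) (taking into account Remark (rem:homsphere))." [BLSW] with Theorem 3.10 = [read: The following is
due to Bergeron and Clozel.] = row D9 `Consumers4.BergeronClozel13` (Corollaire 7 of the cell's arXiv text of D9, `paper-arxiv-1004.1085` p0004:L77-86: every arithmetic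
non-⁶D₄ lattice of SO(n,1) has a finite-index — congruence — subgroup with b_i ≠ 0 for all i ≤ n, « Il découle donc du théorème (RUO) le corollaire » [BC] from their Théorème 6, which « découle également du théorème (A-), voir [SMF]. » — (A-) being
Arthur's results as used in that text; tranche 113's edge `E_BLSWoperatorUnstable` quotes both sides).  THIRD ORDER: the text names neither Arthur nor Bergeron – Clozel
(0 occurrences of either string); its one automorphic ancestor is reached through [3].  The text's second invocation of [3] (Remark 5.16: cocompact lattices of the other
semisimple groups are not {GL_n(ℂ)}-stable) uses C297's general theorem (its Theorem 1.5, compact-dual / Matsushima-type non-vanishing — D9-free) and is NOT an edge.  THE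
AUTHOR'S WORDING: no status sentence (none is to be expected at third remove; recorded, not flagged).  FLAGS: PREPRINT; the statement inherits, through C297 and D9, ALL 24
leaves of the book's DAG — the 2024–2026 preprint layer and the two unwritten weighted fundamental lemmas once everything published is granted
(`stabilityLine_conditional_form`) — in a text of operator algebras; of the cases of Corollary 1.5 only (iii) (n = 4m+3, Λ arithmetic) passes through D9 — C297 proves
case (i) from Agol's theorem (its Theorem 3.9) and case (ii) from its Remark 3.2 (tranche 113's edge docstring records the split; `DIVERGENCE2.md` §DN-g44c) — the register
types statements as printed and does not split them.  NOT TYPED (G-DN-459): the text's Corollary 1.3 and Theorem 1.2 (Arthur-free criteria); Remark 5.16 (D9-free use of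
[3]); the 27 other citing texts of rows C295 – C298 opened in this pass (of 72 local-graph citers; the other 45 — shrinking-target dynamics, random hyperbolic surfaces,
circle packings, metadata-less ids — were graded from titles only and are listed, unadjudicated, in GAPS G-DN-459), all non-uses: Magee's Theorem (BC) restated for
context or his D9-free counting theorems used — P. Sarkar, Adv. Math. (arXiv:2006.07787); *Congruence counting in Schottky and
continued fractions semigroups of SO(n, 1)*, arXiv:2108.00545; A. Mohammadi – H. Oh, JEMS (arXiv:1208.4139): [read: When an explicit uniform spectral gap for {Γ_d} is known
(e.g., [G], [Magee]),]; X. Xiao – X. Zhang, arXiv:2405.14797; arXiv:2410.19551; arXiv:2512.13139; arXiv:2004.00373; arXiv:1707.06708 (no citation in the text) — Kotschick's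
D9-free 4-dimensional theorem restated (arXiv:2303.13219) or bibliography only (arXiv:2602.14945, arXiv:2510.24995) — BLSW's Sp_{2g}(ℤ) / higher-rank results used, not
Corollary 3.13 (F. Glebe arXiv:2312.01533 / arXiv:2509.25869; F. Fournier-Facio arXiv:2512.09180; U. Bader – R. Sauer arXiv:2511.20192; arXiv:2211.10492; B. Bachner –
A. Dogon – A. Lubotzky arXiv:2508.17392; no citation in arXiv:2506.20843 / 2209.05425 / 2305.08720 / 2107.08571) — Kelmer – Yu's general homogeneous-space theorems used, not
Corollary 1.2 (arXiv:2107.12510: [read: we apply the results of Kleinbock–Margulis and Kelmer–Yu]; arXiv:1709.04082, arXiv:2103.08382 bibliography / context; no citation in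
arXiv:2408.01781 / 2510.11371 / 2009.13608).  SUPPORT (canonical reading, `DownstreamSupport14.lean` §118): all 24 book leaves; no Mok / KMSW leaf beyond the inner-form
stabilisation's premises.

**v2: the hundred-and-sixteenth tranche (unit `pub-arthur-down-g46`; GAPS G-DN-463 / G-DN-464).**  With the first-order citers of the book / Mok / KMSW, the local citation
graph and the arXiv listings dry (G-DN-457…462), this unit queried the zbMATH Open CITATION INDEX (`search_string=rf:<zbMATH id>`) of fifty-seven conduit documents of the
register (Gee – Taïbi, Schmidt 2018 / 2020, Chenevier – Lannes, BCGP, Atobe – Gan, Gan – Ichino ×3, Kret – Shin, B. Xu ×3, Taïbi ×2, AMR, Mœglin – Renard ×3, Atobe ×2,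
Atobe – Mínguez, Chenevier – Taïbi, Chenevier – Renard, Clozel – Thorne II / III, BMM ×3, BLMM, Bergeron – Clozel ×2, Lapid – Mao, Ichino – Lapid – Mao, Furusawa – Morimoto ×3,
Marshall – Shin, Shin 2024, Kim – Wakatsuki – Yamauchi, Dalal, Rösner – Weissauer, Jiang – Zhang, LTXZZ, LSZ, LPSZ, Loeffler – Zerbes, BPLZZ, BPCZ, Chen – Zou ×2,
Ishimoto ×2, PSS, the book ×2, Mok): 768 distinct refereed citers, 584 matched to the census by arXiv id / DOI / title, 184 triaged by hand, 36 opened first-hand — two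
PUBLISHED second-order USES, typed here, the rest non-uses or paywalled (GAPS G-DN-463).  ROW C301 (ABSENT; PUBLISHED, IMRN 2024): `GIMSMthetaPrime` := Corollary E
(the Siegel modular form θ_{L,h,2} of class 14λ − 2δ on 𝒜₆ is prime; and, under the text's Condition (⋆), s_Mov(𝒜₆) ≤ 43/6) ⇐ row C6, through the proof's first
sentence « In light of the classiﬁcation of modular forms in low genus and weight in [C T20] » « and [CT], in genus 6 there are no cusp forms in weight 7 , 8, 9, 11, 13. » — the genus-6 level-one dimensions in weights ≤ 13 are entries of Chenevier – Taïbi's printed Theorem 2 (« The dimension of ${\rm S}_k(\Gamma_g)$ for any $k \leq 13$ and any $g\geq 1$ is given by Table (tab:tableleq13scal). »),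
whose computation rests on the book's classification and multiplicity formula (tranche 1's `E_ChenevierTaibi`); the primality follows from them and ord_D θ_{L,h,2} = 2:
« As ord D θL,h,2 = 2, the form θL,h,2 must thus be prime. ».  A statement of the birational geometry of 𝒜₆ — « A6 would help determining the Kodaira dimension of A6, if it turns out that sEﬀ (A6) = 7 = s(KA6 »[…] — inherits the book's open leaves.  ROW C302 (ABSENT as a row —
‘abstract-only, not read’ in G-DN-445 (a)(v); PUBLISHED, IMRN 2024): `DasKrishnaLindelof` := Corollary 1.7 (k³ ≪ Σ_{F ∈ H(2,k)} L(1/2, F) L(1/2, F ⊗ χ₋₄) / L(1, Ad F) ≪_ε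
k^{3+ε} and the same bounds without the adjoint value up to k^{±ε}) ⇐ row C41: the Bergman-kernel bounds of the text are converted into central values by the relation (1.10),
Böcherer's conj. in the refined [DPSS] form « proved by Furusawa, and » « Morimoto [ FM21] » (row C41's Theorem 2, « Suppose that $\varPhi$ is not a Saito-Kurokawa lift. » — through the book's weak lift to GL₄),
« 3.3. Proof of Corollary 1.7. From (3.1) and ( 1.10), we can write after a rearrangement »[that …]; the printed alternative « The corollary above also follows from [ Blo19, (1.8)], but we want to highlight the use of »[…] passes through the same relation, which Blomer's text states as a conj. (« If this is true, then Theorem (thm2) really evaluates a fourth moment of central values, and hence a degree 16 $L$-function! »).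
THE AUTHORS' WORDING: neither text names Arthur (second order; recorded, not flagged).  FLAGS: none; both rows inherit ALL 24 leaves of the book's DAG and no Mok / KMSW leaf
(supports: `DownstreamSupport14.lean` §119).  NOT TYPED (GAPS G-DN-463): the 34 other texts opened in the sweep — non-uses as printed (among them Newton – Thorne, Ann. of Math.
203 (2026), whose CM case cites Clozel – Thorne III only at its Proposition 7.6, a BLGGT potential-automorphy argument without Mok input; Shin – Templier, Invent. Math. 203
(2016), low-lying zeros under an explicit functoriality hypothesis; Loeffler – Zerbes, JEMS 2023, the GSp₄ lift of Sym³ by [KS02] + [Conti19]; Kiefer – Zuffetti, Compositio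
2026; Gan – Gross – Prasad, Compositio 2023; Castella – Liu – Wan, FM Sigma 2022; Möller – Scheithauer, Ann. of Math. 2023; Grbac – Schwermer, Adv. Math. 2021, read in the MPIM
preprint) and the paywalled remainder (H. Lu, Math. Z. 298; K. Morimoto, Math. Z. 299; Kim – Wakatsuki – Yamauchi, Acta Arith. 215; c. 50 analytic citers of Clozel – Thorne).

**v3: the hundred-and-seventeenth tranche (unit `pub-arthur-down-g50`; GAPS G-DN-479 / G-DN-480).**  A citation channel with a different reference parser — the
OpenCitations index (Crossref-deposited reference lists) of the two monographs with a DOI, the book (161 citing records) and Mok's memoir (101) — matched against the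
census (198 of 224 citing entities censused by DOI / arXiv id / title) returned, among texts already adjudicated, the third part of Boisseau – Lu – Xue's Fourier–Jacobi
GGP series (arXiv:2601.01738, 2026; PREPRINT), censused since `pub-arthur-down-g33` as CONTROL E60 (`DOWNSTREAM3.md`, block `[g33c]`: NOT typed, Arthur-free by design on
the strength of the independence sentences p0004:L29 / p0006:L15, the Mok / KMSW Remark p0016:L56 noted, and the census note naming the pattern of row C14).  Re-read:
the classification-dependent statement that note anticipates is a MAIN THEOREM of the text, so the text gets a typed row.  ROW C303 (NEW id; the text of E60):
`BLXggp` := Theorem 1.1 = 4.1 (for a discrete Hermitian Arthur parameter Π of G_n × G_m: L(1/2, Π ⊗ μ̄) ≠ 0 iff some cuspidal σ on some U(V) × U(W), W ⊂ V skew-Hermitian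
of dimensions m, n = m + 2r over the CM extension E/F, with weak base change Π has a non-vanishing Fourier–Jacobi period) — PREMISE-FREE, E60's reading kept
(« independent of [Mok] and [KMSW] »; the proof runs through the text's regular-parameter theorems, declared independent likewise, p0006:L15); `BLXbc` := the NODE —
§1.3's standing hypothesis « so that $\BC(\sigma)$ exists and is generic » for σ cuspidal with σ_v tempered at every v, in the form used (strong base change, isobaric
shape, the group S_σ) — with the SUPPLIER EDGE the text prints in §1.1.3, « by [Mok] and [KMSW] » (p0004:L21-23): Mok at every rank ∧ KMSW's PROVED scope (generic
parameters; the reading of rows C14 / C19 / C26); `BLXii` := Theorem 1.4 = 4.2 (the Ichino–Ikeda-type factorisation |P_{H_W}(φ, ϕ)|² = |S_σ|⁻¹ 𝓛(1/2, σ) ∏_v P♯_v)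
⇐ the node (§4.2 proves it by unfolding to the regular-parameter version, whose hypothesis is the existence of that weak base change, p0031:L51).  TWO READINGS, row
B7's pattern: from the node alone Theorem 1.4 consumes no leaf (`blxIi_of_node`); with the supplier edge it inherits Mok's leaves and KMSW's proved-scope leaves and
no leaf of the book (`blxIi_of_inputs`, `blxIi_conditional_form`) — the residue of rows C14 (Theorem 1.10) / C26.  THE AUTHORS' WORDING: independence declared for
Theorem 1.1 and the regular versions; nothing on Theorem 1.4's dependence beyond the two §1.1.3 sentences (recorded, not flagged).  FLAGS: none.  CENSUS: a regrade
proposal for E60 (control for Theorems 1.1 / 1.5; consumer row C303 for Theorem 1.4) is filed with block `[g50]` of `DOWNSTREAM5.md` — the census keeper decides; no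
status word is changed by this file.  SUPPORT (canonical reading, `DownstreamSupport14.lean` §120, filed after this tranche lands): `BLXggp` — no leaf of any DAG;
`BLXbc`, `BLXii` — Mok's leaves and KMSW's proved-scope leaves.  Parts I / II (arXiv:2404.07342, 2601.01727; not in the census) carry no typed statement: part I names
the Hermitian Arthur parameter only as a pointer to [BPCZ22, Section 1] (PDF text p0003:L19-21), part II cites [Mok15, KMSW] for the LOCAL base change of tempered
representations (p0035:L10-11) — companions of the row.

**Deliberately not here.**  Any claim about the truth of a downstream statement, about group stability, K-theory of group C*-algebras or Betti numbers of hyperbolic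
manifolds beyond what the quoted sentences say; the field of `Consumers115` is an arbitrary proposition and the `E_…` hypothesis records only which typed input the TEXT
invokes.  The canonical reading and the countermodel supports follow in the support file (§118 in `DownstreamSupport14.lean`).
-/

set_option autoImplicit false

namespace Literature.NumberTheory.Automorphic.Arthur2013

namespace Downstream

/-! ## Hundred-and-fifteenth tranche (v1, unit `pub-arthur-down-g44`): THE HYPERBOLIC-MANIFOLDS VEIN, II — NEW row C300 `DadarlatUniformToLocal` (⇐ C297
`Consumers113.BLSWoperatorUnstable`), the first THIRD-ORDER consumer of row D9: group stability in operator algebras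

Context (C300 ABSENT from `DOWNSTREAM.md` … `DOWNSTREAM4.md`; NEW row, block `[g44c]` of `DOWNSTREAM4.md`; found among the local-graph citers of tranche 113's rows (GAPS
G-DN-459); typed premise reused: row C297 `Consumers113.BLSWoperatorUnstable` (tranche 113, `Downstream33.lean`: `Implications113.blsw` ⇐ row D9 `Consumers4.BergeronClozel13`,
itself ⇐ every leaf of the book through `bergeronClozel13_of_leaves` / `bergeronClozel13_conditional_form` of tranche 4) — in the transitive closure of this file's import).
Texts under `HOME/pub-arthur-down-g44/primaries/` (`SHA256SUMS`): `paper-arxiv-2304.04645` (arXiv v1 PDF text, 23 pages, pNNNN = PDF page), `paper-arxiv-2303.08943` (C297).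
Loci: p0001:L3-7, p0001:L19, p0002:L3-4, p0002:L46-52, p0003:L2, p0003:L14-30, p0003:L41-42, p0019:L44-47, p0021:L36-37. -/

/-- NEW row C300 (M. Dadarlat 2023) of the census, as an arbitrary assignment of a truth value: what the register records is which typed input the TEXT invokes (the `E_…` hypothesis below), never the truth of the field. [cite: Arthur2013, downstream register of the cell, hundred-and-fifteenth tranche (structure only)] -/
structure Consumers115 where
  /-- C300 (NEW census row, block `[g44c]` of `DOWNSTREAM4.md`; PREPRINT: arXiv:2304.04645 [math.OA], v1 2023-04-10 = the only version per `api_2304.04645.xml` (read-only GET 2026-08-23; no journal-ref, no DOI; bib Dadarlat2023NonStable NEW); author per the listing: Marius Dadarlat): running head / author line p0003:L1 "NON-STABLE GROUPS" / p0001:L3 "MARIUS DADARLAT" — abstract, first part: p0001:L4-6 "Abstract. In this article we discuss cohomological obstructions to tw o kinds of group stability. In the ﬁrst part, we show that residually ﬁnite groups Γ which arise as fundamental groups of compact Riemannian manifolds with strictly negative secti onal curvature are not uniform-to-local" p0001:L7 "stable with respect to the operator norm if their even Betti n umbers b2i(Γ) do not vanish." — Definition 1.1: p0001:L19 "For a countable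 discrete group Γ we consider sequences {ρn} of unital maps and" […] p0002:L3-4 "(c) Γ is uniform-to-local stable if any sequence {ρn} which satisﬁes the assumption from (b) can be approximated locally by a sequence {πn} of unitary representations." — the programme: p0002:L46 "Motivated by this" p0002:L47-49 "observation, in the ﬁrst part of this paper, we point out that many of the cocompact lattices in the Lorentz group SO0(n, 1),n> 1 are not uniform-to-local stable. This will follow from the following theorem inspired by an idea of Gromov [ 28, p.166]:" — THEOREM 1.2 (the author's criterion; K-theoretic, Arthur-free): p0002:L50-52 "Theorem 1.2. LetM be a closed connected Riemannian manifold with strictly neg ative sectional curvature and residually ﬁnite fundamental group. If b2i(M )̸= 0 for some i >0, then π1(M ) is not uniform-to-local stable." — p0003:L2 "Theorem 1.2 is a direct consequence of Theorem 4.2 from Section 4." — COROLLARY 1.3 (Arthur-free): p0003:L14-16 "Corollary 1.3. Let Γ be a torsion free cocompact lattice in SO0(n, 1). (i) If n is even then Γ is not uniform-to-local stable. (ii) If n is odd and bi(Γ) > 0 for some i> 0 then Γ is not uniform-to-local stable." — p0003:L17 "In order to apply the" p0003:L18-20 "corollary to other examples, let us note that by Selberg’s le mma, any cocompact discrete subgroup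 Λ of SO0(n, 1) has a ﬁnite index torsion free subgroup Γ. Thus, in order to apply Corollary 1.3(ii) to Γ, it remains to realize the condition on Betti numbers." — THEOREM 1.4 (= ROW C297's Corollary 3.13, restated by its cohomological content): p0003:L25-28 "Theorem 1.4 (Cor. 3.13 of [ 3]). Let Λ be a cocompact lattice in SO(n, 1) with n> 1 odd. Suppose either (i) n = 3 or (ii) n = 4m + 1 or (iii) n = 4m + 3 and Λ is arithmetic but not of the form 6D4 if n = 7. Then there is a ﬁnite index subgroup Λ 1≤ Λ such that for any ﬁnite index subgroup Γ≤ Λ 1 there is i> 0 such that b2i(Γ) > 0. In particular, the group Γ is not locally stable." — COROLLARY 1.5 (THE TYPED STATEMENT): p0003:L29-30 "By Theorem 1.2, we deduce: Corollary 1.5. The groups Γ as in Theorem 1.4 are not uniform-to-local stable." [cite: Dadarlat2023NonStable, Cor. 1.5 (arXiv v1 p0003:L29-30), Thm 1.4 (p0003:L25-28), Thm 1.2 (p0002:L50-52)] -/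
  DadarlatUniformToLocal : Prop

variable (ν : Nodes) (μ : Mok2015.Nodes) (κ : KMSW2014.Nodes) (c : Consumers) (c₂ : Consumers2) (c₃ : Consumers3) (c₄ : Consumers4) (c₁₁₃ : Consumers113)
  (c₁₁₅ : Consumers115)

-- Verbatim lines kept out of docstrings by the register's lint (bibliography entries):
-- C300 (`paper-arxiv-2304.04645`) bibliography entry [3]: p0021:L36-37 "[3] U. Bader, A. Lubotzky, R. Sauer, and S. Weinberger. Stabi lity and instability of lattices in semisimple groups. arXiv:2303.08943 [math.GR], 2023. 2, 3, 19"

/-- C300's COROLLARY 1.5 ⇐ ROW C297 — the places: p0003:L21-24 "It was shown in [ 3] that if Γ is a cocompact lattice in a real semisimple Lie grou p G which is not locally isomorphic to either SO(n, 1) for n odd or SL3(R), then b2i(Γ) > 0 for some i >0, so that Γ is not locally stable by [ 17]. Concerning lattices in SO(n, 1), the following nonvanishing result is established in [ 3]." — Theorem 1.4's attribution « Theorem 1.4 (Cor. 3.13 of [ 3]). » and its last sentence « In particular, the group Γ is not locally stable. » — « By Theorem 1.2, we deduce: » « Corollary 1.5. The groups Γ as in Theorem 1.4 are not uniform-to-local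 stable. » — [3] = row C297 `Consumers113.BLSWoperatorUnstable` (U. Bader – A. Lubotzky – R. Sauer – S. Weinberger, *Stability and instability of lattices in semisimple groups*, J. Anal. Math. 151 (2023), cited as arXiv:2303.08943: Corollary 3.13, whose printed conclusion is operator INstability and whose proof supplies the even Betti numbers that Theorem 1.4 states — in C297's text: p0012:L38-39 "Proof. Immediate by Theorem (thm: main old result)(O), given Theorem (thm:SO31), Theorem (thm:BC) and Theorem (thm:nonar) (taking into account Remark (rem:homsphere))." with, for the arithmetic case n = 4k+3, p0012:L6 "The following is due to Bergeron and Clozel." p0012:L8-12 "Theorem 3.10 ( [Ber-Clo13]). Let $\Gamma$ be an arithmetic lattice in $\SO(n,1)$, $n\neq 3$. In case $n= 7$, assume $\Gamma$ is not of the form ${}^{6}D_{4}$. Then there exists a finite index subgroup $\Gamma_1 \leq \Gamma$ such that for every $0 \leq i \leq n$, $H^i(\Gamma_1,\mathbb{Q})\neq 0$. Moreover, for every finite index $\Gamma_2 \leq \Gamma_1$, $H^i(\Gamma_2,\mathbb{Q})\neq 0$." = row D9 `Consumers4.BergeronClozel13` (tranche 113's edge `E_BLSWoperatorUnstable`); the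 cases n = 3 / n = 4k+1 rest there on Agol's theorem (Theorem 3.9) / Remark 3.2 — D9-free; the register types Corollary 1.5 as printed, over all three cases).  The text's second invocation of [3], Remark 5.16: p0019:L44 "In particular, since it was shown in [ 3] that if Γ is a cocompact" p0019:L45-46 "lattice in a real semisimple Lie group G which is not locally isomorphic to either SO(n, 1) for n odd or SL3(R), then b2i(Γ) > 0 for some i> 0, and since Γ is ﬁnitely generated by cocompactness," p0019:L47 "we deduce that Γ is not {GLn(C) : n∈ N}-stable." — uses C297's general theorem for the other semisimple groups (its Theorem 1.5, Matsushima / compact-dual, D9-free) and is not an edge; the examples sentence p0003:L41 "By a result of Li and Millson [ 44], any arithmetic lattice in SO0(n, 1)," p0003:L42 "n̸= 3, 7 contains a congruence subgroup Γ such that b1(Γ) > 0." is Li – Millson (Arthur-free).  THE AUTHOR'S WORDING: no status sentence; the strings ‘Arthur’, ‘Bergeron’, ‘Clozel’ do not occur in the text — the book is reached at third remove, through [3] and its [Ber-Clo13]. [cite: Dadarlat2023NonStable, p0003:L21-30 and Rem. 5.16 (p0019:L44-47); BaderEtAl2023Stability, Thm 3.10 / Cor. 3.13 with proof (arXiv v2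 p0012:L6-39) (edge as printed)] -/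
def E_DadarlatUniformToLocal : Prop := c₁₁₃.BLSWoperatorUnstable → c₁₁₅.DadarlatUniformToLocal

/-- The hundred-and-fifteenth tranche of implications (C300: one edge from C297). [cite: Dadarlat2023NonStable, Cor. 1.5 (edge as printed)] -/
structure Implications115 : Prop where
  dadarlat : E_DadarlatUniformToLocal c₁₁₃ c₁₁₅

variable {ν μ κ c c₂ c₃ c₄ c₁₁₃ c₁₁₅}

/-- THE TRANCHE GIVEN ROW C297. [cite: Dadarlat2023NonStable, Cor. 1.5 (bookkeeping proved here)] -/
theorem stabilityLine_of_row (Y : Implications115 c₁₁₃ c₁₁₅) (h₂₉₇ : c₁₁₃.BLSWoperatorUnstable) : c₁₁₅.DadarlatUniformToLocal :=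
  Y.dadarlat h₂₉₇

/-- THE TRANCHE GIVEN ROW D9, through tranche 113's edge C297 ⇐ D9. [cite: Dadarlat2023NonStable, Cor. 1.5; BaderEtAl2023Stability, Cor. 3.13 (bookkeeping proved here)] -/
theorem stabilityLine_of_D9 (Y : Implications115 c₁₁₃ c₁₁₅) (X : Implications113 c₄ c₁₁₃) (h₉ : c₄.BergeronClozel13) : c₁₁₅.DadarlatUniformToLocal :=
  Y.dadarlat (X.blsw h₉)

/-- THE TRANCHE FROM THE BOOK's INPUTS, through tranche 4's `bergeronClozel13_of_leaves` (D9 ⇐ every leaf of the book, the general weighted FL a second time through the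
inner-form stabilisation) — no Mok / KMSW node beyond those stabilisation inputs. [cite: Dadarlat2023NonStable, Cor. 1.5; BaderEtAl2023Stability, Cor. 3.13; BergeronClozel2010,
Corollaire 7 (bookkeeping proved here)] -/
theorem stabilityLine_of_leaves (Y : Implications115 c₁₁₃ c₁₁₅) (X : Implications113 c₄ c₁₁₃) (I : Implications ν μ κ c) (W : Implications4 ν μ κ c c₂ c₃ c₄)
    (A : BookInputs ν) : c₁₁₅.DadarlatUniformToLocal :=
  stabilityLine_of_D9 Y X (bergeronClozel13_of_leaves I W A)

/-- THE TRANCHE IN CONDITIONAL FORM, 2026 (C300 a PREPRINT of 2023, stated without condition at third remove): granting the book's derivations, the supply edges and every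
PUBLISHED input, Corollary 1.5 is conditional on the 2024–2026 preprint layer and on the two unwritten weighted fundamental lemmas — exactly D9's residue
(`bergeronClozel13_conditional_form`), as for C295 – C297. [cite: Dadarlat2023NonStable, p0003:L25-30; BergeronClozel2010, p0003:L27-30 (bookkeeping proved here)] -/
theorem stabilityLine_conditional_form (Y : Implications115 c₁₁₃ c₁₁₅) (X : Implications113 c₄ c₁₁₃) (I : Implications ν μ κ c) (W : Implications4 ν μ κ c c₂ c₃ c₄)
    (B : ν.BookEdges) (S : ν.SupplyEdges) (P : ν.PublishedLeaves) :
    ν.PreprintLeaves2026 → ν.WFL_general → ν.WFL_nonstandard → c₁₁₅.DadarlatUniformToLocal :=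
  fun hQ h6 h7 => stabilityLine_of_D9 Y X (bergeronClozel13_conditional_form I W B S P hQ h6 h7)

/-- THE WHOLE HUNDRED-AND-FIFTEENTH TRANCHE FROM THE INPUTS OF THE BOOK's DAG AND THE EARLIER TRANCHES' EDGES. [cite: Dadarlat2023NonStable, Cor. 1.5 (bookkeeping proved here)] -/
theorem hundredfifteenth_of_inputs (Y : Implications115 c₁₁₃ c₁₁₅) (X : Implications113 c₄ c₁₁₃) (I : Implications ν μ κ c) (W : Implications4 ν μ κ c c₂ c₃ c₄)
    (A : BookInputs ν) : c₁₁₅.DadarlatUniformToLocal :=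
  stabilityLine_of_leaves Y X I W A

/-! ## Hundred-and-sixteenth tranche (v2, unit `pub-arthur-down-g46`): THE CONDUIT CITATION-INDEX SWEEP — NEW rows C301 `GIMSMthetaPrime` (⇐ C6 `Consumers.ChenevierTaibi`)
and C302 `DasKrishnaLindelof` (⇐ C41 `Consumers67.FMBessel`): the moving slope of 𝒜₆ and a Lindelöf-on-average for spinor central values, both at second remove

Context (C301, C302 ABSENT from `DOWNSTREAM.md` … `DOWNSTREAM4.md` as rows — C302's text was listed ‘abstract-only, not read’ among the DPSS citers in GAPS G-DN-445 (a)(v);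
NEW rows, block `[g46]` of `DOWNSTREAM4.md`; found by the zbMATH Open citation index (`rf:<id>`) of fifty-seven conduit documents of the register matched against the census
files (GAPS G-DN-463); typed premises reused: row C6 `Consumers.ChenevierTaibi` (tranche 1, `Downstream.lean`: `Implications.ct` ⇐ the book at every rank ∧ row B1 `AMR` ∧ row C4
`TaibiDim`, with `chenevierTaibi_of_leaves` and — `Downstream4.lean` — `chenevierTaibi_conditional_form`) and row C41 `Consumers67.FMBessel` (tranche 67, `Downstream18.lean`:
`Implications67.fmBessel` ⇐ the book at every rank) — both in the transitive closure of this file's import.  Texts under `HOME/pub-arthur-down-g46/primaries/` (`SHA256SUMS`):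
`paper-arxiv-2207.04139` (C301: arXiv v1 PDF text, 25 pages, pNNNN = PDF page — the only arXiv version per `arxivpdf/api_2207.04139_2206.02190.xml`, read-only GET 2026-08-23;
journal text IMRN 2024 no. 4, 3442–3486, doi:10.1093/imrn/rnad203, not held), `paper-arxiv-2206.02190` (C302: arXiv v1 PDF text, 39 pages — the only arXiv version; journal text
IMRN 2024 no. 7, 6140–6175, doi:10.1093/imrn/rnad322, not held), and the conduits' corpus TeX texts `paper-arxiv-1907.08783` (C6), `paper-arxiv-1611.05567` (C41),
`paper-arxiv-1602.00780` (V. Blomer, JEMS 21 (2019), the arXiv text of C302's [Blo19]).  Loci: C301 p0001:L1-11, p0002:L33-36, p0004:L22-31, p0015:L40-62, p0023:L49-54;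
C302 p0001:L1-12, p0004:L56-67, p0005:L17-48, p0012:L15-39, p0038:L7-8, p0038:L42-43, p0039:L14-15. -/

/-- NEW rows C301 (Grushevsky – Ibukiyama – Mondello – Salvati Manni 2024) and C302 (Das – Krishna 2024) of the census, as an arbitrary assignment of truth values: what the
register records is which typed input each TEXT invokes (the `E_…` hypotheses below), never the truth of a field. [cite: Arthur2013, downstream register of the cell, hundred-and-sixteenth tranche (structure only)] -/
structure Consumers116 where
  /-- C301 (NEW census row, block `[g46]` of `DOWNSTREAM4.md`; PUBLISHED: Int. Math. Res. Not. IMRN 2024, no. 4, 3442–3486, doi:10.1093/imrn/rnad203; bib GrushevskyEtAl2024MovingSlope NEW; typed on the arXiv text): p0001:L1 "arXiv:2207.04139v1  [math.AG]  8 Jul 2022" / p0001:L2-3 "DIFFERENTIA TING SIEGEL MODULAR FORMS AND THE MOVING SLOPE OF Ag" / p0001:L4-5 "SAMUEL GRUSHEVSKY, TOMOYOSHI IBUKIYAMA, GABRIELE MONDELL O, AND RICCARDO SAL V ATI MANNI" — abstract: p0001:L6-9 "Abstract. W e study the cone of moving divisors on the moduli space Ag of principally polarized abelian varieties. Partly motivated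 by the generalized Ran kin-Cohen bracket, we construct a non-linear holomorphic diﬀerential operator that sends Siegel modula r forms to Siegel modular forms, and we apply it to produce new modular forms. Our construction recovers t he known divisors of minimal moving slope" p0001:L10 "on Ag for g ≤ 4, and gives an explicit upper bound for the moving slope of A5" — the motivation for genus 6: p0002:L33 "For g = 6 the knowledge of the moving slope of" p0002:L34-36 "A6 would help determining the Kodaira dimension of A6, if it turns out that sEﬀ (A6) = 7 = s(KA6 ). As in the case g = 5, though, the moving slope of Ag remains unknown at present for every g ≥ 6." — the slope table's genus-6 line and the form θ_{L,h,2}: p0004:L22-23 "g = 6 [ 53 10 , 7] (?) ≤ 43/6 = 7 .166 . . ." […] p0004:L25 "where the upper bound sEﬀ (A6) ≤ 7 is provided by the Siegel modular form θL,h,2 of class 14 λ − 2δ" — COROLLARY E (THE TYPED STATEMENT; algebraic geometry of the moduli space 𝒜₆ of principally polarised abelian sixfolds): p0004:L28-31 "Corollary E. The form θL,h,2 on A6 is prime, i.e. not a product of non-constant Siegel modular f orms. Moreover, if θL,h,2 satisﬁes Condition (⋆), then sMov(A6) ≤ 43 6 ." — §5.6: p0015:L40-43 "5.6. Case g = 6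 . For genus 6, the slope is bounded from below s(A6) ≥ 53 10 by [FaVe16]. Moreover, an interesting Siegel modular form θL,h,2 of class 14 λ − 2δ was constructed in [DSMS21], showing that s(A6) ≤ 7 and that the Kodaira dimension of A6 is non-negative." — and after the proof: p0015:L61-62 "In the above case (a) the moduli space A6 would have Kodaira dimension at least 1, in case (b) it would have Kodaira dimension 0." [cite: GrushevskyEtAl2024MovingSlope, Cor. E (arXiv v1 p0004:L28-31), §5.6 (p0015:L40-62)] -/
  GIMSMthetaPrime : Prop
  /-- C302 (NEW census row, block `[g46]` of `DOWNSTREAM4.md`; PUBLISHED: Int. Math. Res. Not. IMRN 2024, no. 7, 6140–6175, doi:10.1093/imrn/rnad322; bib DasKrishna2024Bergman NEW; typed on the arXiv text): p0001:L1 "arXiv:2206.02190v1  [math.NT]  5 Jun 2022" / p0001:L2-3 "BOUNDS FOR THE BERGMAN KERNEL AND THE SUP-NORM OF HOLOMORPHIC SIEGEL CUSP FORMS" / p0001:L4 "SOUMYA DAS AND HARIRAM KRISHNA" — abstract: p0001:L5 "Abstract. We prove ‘polynomial in k’ bounds on the size of the Bergman kernel for the" p0001:L6 "space of holomorphic Siegel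 cusp forms of degree n and weight k." […] p0001:L8 "For an L2-normalised Siegel cusp form F of degree 2, our bound for its sup-" p0001:L9-12 "norm is Oǫ(k9/4+ǫ). Further, we show that in any compact set Ω (which does not depend on k) contained in the Siegel fundamental domain of Sp(2, Z) on the Siegel upper half space, the sup-norm of F is OΩ (k3/2− η) for some η > 0, going beyond the ‘generic’ bound in this setting." — the non-lift space (k even and large): p0004:L56-67 "When n = 2, put Bk(Z, Z)♯ := ∑ F ∈B♯ k det(Y )k|F (Z)|2, where B♯ k is a Hecke basis for S♯ k ⊂ S2 k, the orthogonal complement of the space spanned by the Saito-Kurokawa lifts. Then the following corollary sho ws that the bulk of the contribution to Bk(Z, Z) comes from the non-lifts, as is expected. Let k be even and large." — p0005:L17-18 "Our next corollary concerns the spinor zeta function L(s, F ) of F . Let F ∈ S2 k be an" [L²-normalised Hecke eigenform; the sentence invoking Böcherer's conj. as proved by Furusawa – Morimoto is in the `--` comment below] — the relation (1.10): p0005:L21-24 "aF (12)2 = 256π11/2(4π)2k−3Γ(2 k − 4) Γ( k − 3/2)Γ( k − 2)Γ(2 k − 1) L(1/2, F )L(1/2, F ⊗ χ−4) L(1, AdF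 ) ; (1.10)" p0005:L25-32 "where 12 = ( 1 0 0 1 ) and L(s, F ⊗ χ−4) denotes the spinor zeta function twisted by the unique quadratic character mod 4. Asymptotics of spectrally weighted averages of related fa mily of L-functions were obtained in [ Blo19]. Our main theorem implies the following sharp result about Lindelöf on average for the family of the produc ts of the central L-values L(1/2, F )L(1/2, F ⊗ χ−4). Let L(s, AdF ) denote the degree 10 adjoint L-function of F . Let H(2, k) be the set of L2-normalised Hecke eigenforms in S2" — COROLLARY 1.7 (THE TYPED STATEMENT; a Lindelöf-on-average for the products of central spinor values over the level-one Hecke eigenbasis H(2,k)): p0005:L33-34 "k. We appeal to ( 1.10) the bounds on L(1, AdF ) from [ Li10] to arrive at the following." p0005:L35-44 "Corollary 1.7. k3 ≪ ∑ F ∈H(2,k) L(1/2, F )L(1/2, F ⊗ χ−4) L(1, AdF ) ≪ǫ k3+ǫ (1.11) k3−ǫ ≪ ∑ F ∈H(2,k) L(1/2, F )L(1/2, F ⊗ χ−4) ≪ǫ k3+ǫ. (1.12)" — p0005:L45 "The corollary above also follows from [ Blo19, (1.8)], but we want to highlight the use of" [cite: DasKrishna2024Bergman, Cor. 1.7 (arXiv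 v1 p0005:L33-45), (1.10) (p0005:L17-32)] -/
  DasKrishnaLindelof : Prop

variable (ν : Nodes) (μ : Mok2015.Nodes) (κ : KMSW2014.Nodes) (c : Consumers) (c₆ : Consumers6) (c₈ : Consumers8) (c₆₇ : Consumers67) (c₁₁₆ : Consumers116)

-- Verbatim lines kept out of docstrings by the register's lint (bibliography entries and sentences naming a conj.):
-- C301 (`paper-arxiv-2207.04139`) abstract, last sentence: p0001:L10-11 "on Ag for g ≤ 4, and gives an explicit upper bound for the moving slope of A5 and a conjectural upper bound for the moving slope of A6."
-- C301 the table's question mark: p0004:L26-27 "constructed in [DSMS21]. The question mark in the above table marks a conjectural upper bound sMov(A6) ≤ 43/6, which is a consequence of the following."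
-- C301 bibliography: p0023:L49-50 "[CT20] G. Chenevier and O Ta ¨ ıbi.Discrete series multiplicities for classical groups over Z and level 1 algebraic cusp forms. Publ. Math. Inst. Hautes ´Etudes Sci. 131 (2020), 261–323." / p0023:L51-54 "[CT] G. Chenevier and O Ta ¨ ıbi.https://gaetan.chenevier.perso.math.cnrs.fr/levelone/siegel/siegel genus6.txt , computer-based results, where ( k, k, k, k, k, k) : d indicates that the vector space of Siegel cusp forms of weigh t k on A6 is d-dimensional."
-- C302 (`paper-arxiv-2206.02190`) abstract, second sentence: p0001:L6-8 "space of holomorphic Siegel cusp forms of degree n and weight k. When n = 1, 2 our bounds agree with the conjectural bounds on the aforementioned siz e, while the lower bounds match for all n ≥ 1. For an L2-normalised Siegel cusp form F of degree 2, our bound for its sup-"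
-- C302 THE INVOCATION SENTENCE introducing (1.10): p0005:L19-20 "L2-normalised Hecke eigenform. By Böcherer’s conjecture [ Böc86], proved by Furusawa, and Morimoto [ FM21] (see also the discussion in [ Blo19]) one has the relation"
-- C302 after Corollary 1.7: p0005:L46-48 "the methods of this paper to obtain the such results. In parti cular, on Conjecture 1.1 for F , we can show that one would get the Lindelöf conjecture for L(1/2, F )L(1/2, F ⊗ χ−4) by using ( 1.10) – see subsection 3.3 for this and the proof of the above corollary."
-- C302 bibliography: p0038:L42-43 "[FM21] M. Furusawa and K. Morimoto. Reﬁned global Gross-Pra sad conjecture on special Bessel periods and Böcherer’s conjecture. J. Eur. Math. Soc. (JEMS) , 23(4):1295–1331, 2021." / p0038:L7-8 "[Blo19] V. Blomer. Spectral summation formula for GSp(4) and moments of spinor L functions, J. Eur. Math. Soc., 21(6):1751–1774, 2019." / p0039:L14-15 "[Li10] X. Li. Upper bounds on L-functions at the edge of the critical strip. Int. Math. Res. Not. (IMRN) , 4:727–755, 2010."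
-- C41's text (`paper-arxiv-1611.05567`) §1.4 before its Theorem 2: p0007:L104-109 "Theorem (t: main theorem) yields a proof of the long-standing conjecture of Böcherer [Bo] concerning central critical values of imaginary quadratic twists of spinor $L$-functions for holomorphic Siegel cusp forms of degree two which are Hecke eigenforms, thanks to the recent work of Dickson, Pitale, Saha and Schmidt [DPSS]. Namely Böcherer's conjecture holds in the following refined form."
-- [Blo19]'s arXiv text (`paper-arxiv-1602.00780`, 2016), where the relation later numbered (1.10) by C302 is a conj.: p0004:L27 "Böcherer [Bo] made a remarkable conjecture that $\omega_{F, k}$ should (in addition) be related to central $L$-values." […] p0004:L36 "If this is true, then Theorem (thm2) really evaluates a fourth moment of central values, and hence a degree 16 $L$-function!"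

/-- C301's COROLLARY E ⇐ ROW C6 — the place (proof of Corollary E, §5.6): p0015:L44-49 "Proof of Corollary E. In light of the classiﬁcation of modular forms in low genus and weight in [C T20] and [CT], in genus 6 there are no cusp forms in weight 7 , 8, 9, 11, 13. Now, in genus 6 there are no Siegel modular forms of weight 2 and we have seen above that s(A6) ≥ 53 10 . Hence, the unique (up to multiple) cusp form of weight 10 vanishes with multiplicity one along D (and so does a possible cusp form in weight 6). As ord D θL,h,2 = 2, the form θL,h,2 must thus be prime." — continued: p0015:L50-60 "As for the second claim, there are two possibilities: (a) there exists a Siegel modular form of slope at most 7, not divisible by θL,h,2: in this case, from Lemma 2.2 it follows that sMov(A6) ≤ 7; (b) θL,h,2 is the unique genus 6 Siegel modular form of slope 7 (up to taking powe rs): the claim then follows from Corollary B, since s(D6,14(θL,h,2)) = 7 + 2 2·6 = 43 6 (as usual, if it happened that D6,14(θL,h,2) were to vanish to order strictly higher than 6 · 2 = 12, then its slope would be at most 86 13 < 7). In either case, the result is proven. □" — [CT20] = row C6 `Consumers.ChenevierTaibi` (G. Chenevier – O. Taïbi, Publ. Math. IHÉS 131 (2020) = arXiv:1907.08783, whose typed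 field is its Theorems 1, 2, 3, 5; the genus-6 dimensions in weights ≤ 13 used here — no cusp forms in weights 7, 8, 9, 11, 13, one in weight 10 up to multiple — are entries of its printed Theorem 2 / Table for scalar weights k ≤ 13 and every genus, in C6's text: p0003:L60-67 "Theorem 2. The dimension of ${\rm S}_{\underline{k}}(\Gamma_g)$ for $13 \geq k_1 \geq \dots \geq k_g >g$, and $\underline{k}$ non scalar, is given by Table (tab:tableleq13nonscal). The dimension of ${\rm S}_k(\Gamma_g)$ for any $k \leq 13$ and any $g\geq 1$ is given by Table (tab:tableleq13scal)." and p0003:L73-74 "Table (tab:tableleq13scal) includes the fact that ${\rm S}_k(\Gamma_g)$ vanishes whenever $k \leq 13$ and $g \geq k$, except in the three following situations:"); [CT] = the same authors' on-line table `siegel_genus6.txt` of dim S_k(Γ₆) for all k (the ‘implemented formula’ of [CT20]'s Theorem 1, g ≤ 8), cited side by side — the register reads the pair ‘[CT20] and [CT]’ as ONE premise, row C6, since every dimension the proof names lies in [CT20]'s printed k ≤ 13 table; the lower slope bound s(𝒜₆) ≥ 53/10 [FaVe16], the form θ_{L,h,2} of [DSMS21] with ord_D = 2, Lemma 2.2 and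 Corollary B are the text's own or Arthur-free inputs (absorbed).  SECOND ORDER: the text names neither Arthur nor the endoscopic classification (0 occurrences of ‘Arthur’ in 25 pages); the book is reached through [CT20], whose level-one dimension formulas rest on the book's classification and multiplicity formula (tranche 1's `E_ChenevierTaibi`: the book at every rank, AMR, Taïbi's dimension formula).  THE AUTHORS' WORDING: no status sentence (none is to be expected at second remove; recorded, not flagged). [cite: GrushevskyEtAl2024MovingSlope, proof of Cor. E (arXiv v1 p0015:L44-60); ChenevierTaibi2020, Thm 2 (arXiv text p0003:L60-74) (edge as printed)] -/
def E_GIMSMthetaPrime : Prop := c.ChenevierTaibi → c₁₁₆.GIMSMthetaPrime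

/-- C302's COROLLARY 1.7 ⇐ ROW C41 — the places: the relation (1.10) is introduced by the sentence kept in the `--` comment above (« proved by Furusawa, and » « Morimoto [ FM21] (see also the discussion in [ Blo19]) one has the relation ») and used in the proof: p0012:L15-16 "3.3. Proof of Corollary 1.7. From (3.1) and ( 1.10), we can write after a rearrangement that" […] p0012:L34-39 "from which ( 1.11) in Corollary 1.7 easily follows. The lower bound follows from the lower bound of ∑ F ∈H(2,k) aF (12)2 from ( 3.3) and the same calculations as shown above. We leave the details to the reader. The second inequality ( 1.12) then follows from ( 1.11) by using the following bounds for L(1, AdF ) (cf. [ Li10]): k−ǫ ≪ǫ L(1, AdF ) ≪ǫ kǫ." — [FM21] = row C41 `Consumers67.FMBessel` (M. Furusawa – K. Morimoto, J. Eur. Math. Soc. 23 (2021), whose typed field is its Theorem 1 and Theorem 2 = Böcherer's conj. in the refined form of [DPSS] for full-level non-lift Hecke eigenforms — in C41's text: p0007:L111-118 "Theorem 2. Let $\varPhi$ be a holomorphic Siegel cusp form of degree two and weight $k$ with respect to $\operatorname{Sp}_2\left(\mathbb Z\right)$ which is a Hecke eigenform and $\pi\left(\varPhi\right)$ the associated automorphic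 representation of $\operatorname{PGSp}_2\left(\mA\right)\simeq \mathbb G_2\left(\mA\right)$. Suppose that $\varPhi$ is not a Saito-Kurokawa lift."; tranche 67's edge `E_FMBessel` ⇐ the book at every rank: the weak lift of the tempered π to GL₄ « is guaranteed by Arthur [Ar] »); (1.10) is that theorem at E = ℚ(√−1) with the explicit constant, applied to every F ∈ H(2,k) — for the Saito – Kurokawa lifts among them the relation is classical (Arthur-free, absorbed), for the non-lifts it is C41; (3.1) / (3.3) (the text's Bergman-kernel bounds, its Theorem 1.3) and [Li10] (X. Li's bounds for L(1, Ad F), IMRN 2010; the degree-10 adjoint L-function of a full-level form through the Arthur-free full-level transfer, as in row C264's record) are Arthur-free inputs (absorbed).  THE PRINTED ALTERNATIVE « also follows from [ Blo19, (1.8)] » is NOT Arthur-free: in [Blo19]'s text the passage from the harmonic weights ω_{F,k} to central values is Böcherer's conj. itself, stated there as such (the `--` comment line on [Blo19]'s 2016 arXiv text above; there: « If this is true, then Theorem (thm2) really evaluates a fourth moment of central values, and hence a degree 16 $L$-function! ») — i.e. again C41 once proved; no C41-free route to Corollary 1.7 is printed.  SECOND ORDER: ‘Arthur’ does not occur in the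 text (39 pages); the book is reached through [FM21].  THE AUTHORS' WORDING: no status sentence (recorded, not flagged). [cite: DasKrishna2024Bergman, (1.10) and Cor. 1.7 (arXiv v1 p0005:L17-45), §3.3 (p0012:L15-39); FurusawaMorimoto2021Bessel, Thm 2 (arXiv text p0007:L111-118) (edge as printed)] -/
def E_DasKrishnaLindelof : Prop := c₆₇.FMBessel → c₁₁₆.DasKrishnaLindelof

/-- The hundred-and-sixteenth tranche of implications (C301: one edge from C6; C302: one edge from C41). [cite: GrushevskyEtAl2024MovingSlope, Cor. E; DasKrishna2024Bergman, Cor. 1.7 (edges as printed)] -/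
structure Implications116 : Prop where
  gimsm : E_GIMSMthetaPrime c c₁₁₆
  dasKrishna : E_DasKrishnaLindelof c₆₇ c₁₁₆

variable {ν μ κ c c₆ c₈ c₆₇ c₁₁₆}

/-- THE TRANCHE GIVEN ITS ROWS (C6 and C41). [cite: GrushevskyEtAl2024MovingSlope, Cor. E; DasKrishna2024Bergman, Cor. 1.7 (bookkeeping proved here)] -/
theorem sweep116_of_rows (Y : Implications116 c c₆₇ c₁₁₆) (h₆ : c.ChenevierTaibi) (h₄₁ : c₆₇.FMBessel) :
    c₁₁₆.GIMSMthetaPrime ∧ c₁₁₆.DasKrishnaLindelof :=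
  ⟨Y.gimsm h₆, Y.dasKrishna h₄₁⟩

/-- C301 FROM THE BOOK's INPUTS, through tranche 1's `chenevierTaibi_of_leaves` (C6 ⇐ every leaf of the book: directly, through AMR and through Taïbi's dimension formula).
[cite: GrushevskyEtAl2024MovingSlope, Cor. E; ChenevierTaibi2020, Thms 1, 2 (bookkeeping proved here)] -/
theorem gimsm_of_leaves (Y : Implications116 c c₆₇ c₁₁₆) (I : Implications ν μ κ c) (A : BookInputs ν) : c₁₁₆.GIMSMthetaPrime :=
  Y.gimsm (chenevierTaibi_of_leaves I A)

/-- C301 IN CONDITIONAL FORM, 2026 (a PUBLISHED corollary on the moduli of abelian sixfolds, stated without condition at second remove): granting the book's derivations, its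
supply edges and every PUBLISHED input, Corollary E is conditional on the 2024–2026 preprint layer and on the two unwritten weighted fundamental lemmas — exactly C6's residue
(`chenevierTaibi_conditional_form` of `Downstream4.lean`). [cite: GrushevskyEtAl2024MovingSlope, p0015:L44-49; ChenevierTaibi2020, Thm 2 (bookkeeping proved here)] -/
theorem gimsm_conditional_form (Y : Implications116 c c₆₇ c₁₁₆) (I : Implications ν μ κ c) (B : ν.BookEdges) (S : ν.SupplyEdges) (P : ν.PublishedLeaves) :
    ν.PreprintLeaves2026 → ν.WFL_general → ν.WFL_nonstandard → c₁₁₆.GIMSMthetaPrime :=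
  fun hQ h6 h7 => Y.gimsm (chenevierTaibi_conditional_form I B S P hQ h6 h7)

/-- C302 FROM THE BOOK's INPUTS, through tranche 67's edge `Implications67.fmBessel` (C41 ⇐ the book at every rank). [cite: DasKrishna2024Bergman, Cor. 1.7; FurusawaMorimoto2021Bessel,
Thm 2 (bookkeeping proved here)] -/
theorem dasKrishna_of_leaves (Y : Implications116 c c₆₇ c₁₁₆) (Z : Implications67 ν μ κ c c₆ c₈ c₆₇) (A : BookInputs ν) : c₁₁₆.DasKrishnaLindelof :=
  Y.dasKrishna (Z.fmBessel A.everything)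

/-- C302 IN CONDITIONAL FORM, 2026 (a PUBLISHED corollary of analytic number theory, stated without condition at second remove): granting the book's derivations, supply edges and
every PUBLISHED input, Corollary 1.7 is conditional on the 2024–2026 preprint layer and on the two unwritten weighted fundamental lemmas — exactly C41's residue
(`periods_bookRows_conditional_form` of tranche 67). [cite: DasKrishna2024Bergman, p0005:L33-45; FurusawaMorimoto2021Bessel, p0006:L115-117 (bookkeeping proved here)] -/
theorem dasKrishna_conditional_form (Y : Implications116 c c₆₇ c₁₁₆) (Z : Implications67 ν μ κ c c₆ c₈ c₆₇) (B : ν.BookEdges) (S : ν.SupplyEdges) (P : ν.PublishedLeaves) :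
    ν.PreprintLeaves2026 → ν.UnwrittenLeaves → c₁₁₆.DasKrishnaLindelof :=
  fun Q U => dasKrishna_of_leaves Y Z ⟨B, S, P, Q, U⟩

/-- THE WHOLE HUNDRED-AND-SIXTEENTH TRANCHE FROM THE INPUTS OF THE BOOK's DAG AND THE EARLIER TRANCHES' EDGES — no Mok / KMSW node beyond the book's own record of the
inner-form stabilisation. [cite: GrushevskyEtAl2024MovingSlope, Cor. E; DasKrishna2024Bergman, Cor. 1.7 (bookkeeping proved here)] -/
theorem hundredsixteenth_of_inputs (Y : Implications116 c c₆₇ c₁₁₆) (I : Implications ν μ κ c) (Z : Implications67 ν μ κ c c₆ c₈ c₆₇) (A : BookInputs ν) :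
    c₁₁₆.GIMSMthetaPrime ∧ c₁₁₆.DasKrishnaLindelof :=
  ⟨gimsm_of_leaves Y I A, dasKrishna_of_leaves Y Z A⟩

/-! ## Hundred-and-seventeenth tranche (v3, unit `pub-arthur-down-g50`): THE TEXT OF CONTROL E60 HAS A CONSUMER THEOREM — NEW row C303 Boisseau – Lu – Xue 2026,
*The global GGP statement for Fourier–Jacobi periods on unitary groups III* (`BLXggp` = Theorem 1.1 = 4.1, premise-free by the authors' own sentence — the control;
`BLXbc` = the standing hypothesis of §1.3 as a NODE, supplied « by [Mok] and [KMSW] » in the text's words; `BLXii` = Theorem 1.4 = 4.2, the Ichino–Ikeda-type formula for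
Fourier–Jacobi periods ⇐ the node)

Context.  The text is censused since unit `pub-arthur-down-g33` as CONTROL E60 of `DOWNSTREAM3.md` (block `[g33c]`: census only, NOT typed, ‘Arthur-free by design’ on the
strength of the two independence sentences p0004:L29 / p0006:L15, with the Mok / KMSW Remark p0016:L56 noted and the census note ‘the pattern of row C14's Theorem 1.8:
Arthur-free main theorems next to a classification-dependent corollary’).  Re-read by this unit when the OpenCitations index of the reference lists citing Mok's memoir
(10.1090/memo/1108) returned it outside the census by DOI / title (GAPS G-DN-479): the classification-dependent statement that E60's note anticipates is a MAIN THEOREM of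
the text — Theorem 1.4 (= Theorem 4.2), the Ichino–Ikeda-type formula, whose standing hypothesis « We henceforth assume that $\sigma_v$ is tempered at all places $v$ so that $\BC(\sigma)$ exists and is generic. »
rests on §1.1.3's « If we assume that all the $\mathrm{BC}(\sigma_v)$ are generic, then by [Mok] and [KMSW], $\mathrm{BC}(\sigma)$ always exists and is a strong base-change »
and whose constant |S_σ| is defined through the isobaric decomposition that « [Mok] and [KMSW] also tell us ».  NEW row C303 (block `[g50]` of `DOWNSTREAM5.md`; the row id is
new, the text is E60's — a regrade proposal for the census keeper is filed with the block), typed in the pattern of row B7 / row C14: the hypothesis as a node with the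
text's own supplier sentence, the theorem AS STATED from the node, the GGP-type equivalence premise-free beside it.  The text is the third part of the authors' split of
arXiv:2404.07342 (I = arXiv:2404.07342v3, the coarse expansions of Liu's relative trace formulae; II = arXiv:2601.01727, their comparison; III = arXiv:2601.01738v1 of
2026-01-05, the main theorems; PREPRINT).  Texts under `HOME/pub-arthur-down-g50/primaries/` (`SHA256SUMS`): `paper-arxiv-2601.01738` (the cell corpus's TeX-derived
chunks, 47 — the text E60 was censused on; pNNNN:Ln = chunk : line), `paper-arxiv-2601.01727` (arXiv PDF text, 62 pages), `paper-arxiv-2404.07342` (arXiv v3 PDF text,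
299 pages).  Loci (part III): p0001:L1-9, p0003:L39-41, p0004:L9, L19-37, L58-60, p0005:L6, L19-26, p0006:L11-15, p0016:L44, L56, p0031:L45-51, p0043:L3-30, L50-71,
p0046:L59, L178. -/

/-- NEW row C303 (Boisseau – Lu – Xue 2026; the text of control E60) of the census, as an arbitrary assignment of truth values: what the register records is which typed
input the TEXT invokes (the `E_…` hypotheses below), never the truth of a field. [cite: Arthur2013, downstream register of the cell, hundred-and-seventeenth tranche (structure only)] -/
structure Consumers117 where
  /-- C303 (NEW census row, block `[g50]` of `DOWNSTREAM5.md`; = the text of control E60 of `DOWNSTREAM3.md`; PREPRINT arXiv:2601.01738v1, 2026-01-05, third part of the split of arXiv:2404.07342; bib BoisseauLuXue2026FourierJacobiIII NEW; typed on the corpus TeX chunks): authors p0001:L3 "Paul Boisseau, Max Planck Institute for Mathematics" / p0001:L6 "Weixiao Lu, Aix Marseille Univ, CNRS, I2M" / p0001:L9 "Hang Xue, Department of Mathematics, The University of Arizona" — setting: p0003:L39 "Let $E/F$ be a quadratic extension of number fields, and write $\bA$ (resp. $\bA_E$) for the ring of adeles of $F$ (resp. of $E$)." p0003:L41 "We fix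 $n$ and $m$ two integers such that $n=m+2r$ with $r$ a non-negative integer. Let $W \subset V$ be two non-degenerate skew-Hermitian spaces of respective dimensions $m$ and $n$. We assume that $W^\perp$ is split" — the period: p0004:L9 "Let $\sigma$ be a cuspidal automorphic representation of $\cU_W(\bA)$. The Fourier–Jacobi period is the absolutely convergent integral" — weak base change: p0004:L19 "We say that $\sigma$ admits a weak base-change if there exists a discrete automorphic representation $\BC(\sigma)$ of $G_n \times G_m$ such that, at almost all split places $v$, $\BC(\sigma)_v$ is the split base change of $\sigma_v$. By [Ram], such a representation is unique." — p0004:L25 "Conversely, any automorphic representation $\Pi$ of $G_n \times G_m$ that can be written as an induction with the above desiderata is called a discrete Hermitian Arthur parameter." — THEOREM 1.1 (THE FIRST TYPED STATEMENT, THE CONTROL; the global GGP-type equivalence for Fourier–Jacobi periods on U(V) × U(W), arbitrary corank n = m + 2r, in the weak-base-change formulation): p0004:L31 "Theorem 1.1." p0004:L33 "Let $\Pi$ be a discrete Hermitian Arthur parameter of $G_n \times G_m$. Then the following assertions are equivalent:" p0004:L35 "* the complete Rankin–Selberg $L$-function satisfies $L(\frac{1}{2}, \Pi \otimes \overline{\mu})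 \neq 0$;" p0004:L37 "* there exist two non-degenerate skew-Hermitian spaces $W\subset V$ of respective dimensions $m$ and $n$ and $\sigma$ a cuspidal automorphic representation of $\cG_{W}$ such that $W^\perp$ is split, the weak base-change of $\sigma$ is $\Pi$, and $\cP_{\cH_{W}}$ does not vanish identically on $\sigma \otimes \nu^\vee$." — proved as Theorem 4.1: p0043:L9 "Theorem 4.1." p0043:L10-11 "Let $\Pi$ be a discrete Hermitian Arthur parameter of $G_n \times G_m$. The following assertions are equivalent:" p0043:L13 "* $L(\frac{1}{2}, \Pi \otimes \overline{\mu}) \neq 0$;" p0043:L15-17 "* there exist non-degenerate skew-Hermitian spaces $W\subset V$ and $\sigma$ a cuspidal automorphic representation of $\U(V)(\bA) \times \U(W)(\bA)$ such that $W^\perp$ is split, the weak base change of $\sigma$ to $G_n \times G_m$ is $\Pi$ and $\cP_{\cH_W}$ does not vanish identically on $\sigma \otimes \nu^\vee$." [cite: BoisseauLuXue2026FourierJacobiIII, Thm 1.1 (corpus chunks p0004:L31-37) = Thm 4.1 (p0043:L9-17)] -/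
  BLXggp : Prop
  /-- C303, THE NODE: the standing hypothesis of §1.3 in the form the text uses it — for σ cuspidal on U(V) × U(W) with σ_v tempered at every place v, the strong base change BC(σ) = BC(σ)_n ⊠ BC(σ)_m to G_n × G_m exists and is a discrete Hermitian Arthur parameter (each BC(σ)_k an isobaric sum of mutually non-isomorphic conjugate-self-dual cuspidal representations with the prescribed Asai pole, giving the group S_σ): p0004:L60 "We go back to the global setting and let $\sigma$ be a cuspidal automorphic representation of $\cU_W$. We henceforth assume that $\sigma_v$ is tempered at all places $v$ so that $\BC(\sigma)$ exists and is generic." — resting on §1.1.3: p0004:L21 "There is also a notion of strong base-change. By local Langlands functoriality, for all place $v$ the representation $\sigma_v$ admits a base-change $\mathrm{BC}(\sigma_v)$ which is a smooth irreducible representation of $G_n(F_v) \times G_m(F_v)$. If we assume that all the $\mathrm{BC}(\sigma_v)$ are generic, then by [Mok] and [KMSW], $\mathrm{BC}(\sigma)$ always exists and is a strong base-change, i.e. it satisfies $\mathrm{BC}(\sigma)_v=\mathrm{BC}(\sigma_v)$ for all $v$." p0004:L23 "In the generic case, for $k \in \{n,m\}$ [Mok] and [KMSW] also tell us that $\BC(\sigma)_k$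 can be written as a parabolic induction $\pi_{k,1} \times \hdots \times \pi_{k,r_k}$ where the $\pi_{k,i}$ are cuspidal self-dual automorphic representations of some $G_l$'s, mutually non-isomorphic, and such that the Asai $L$-functions $L(s,\pi_{k,i},\As^{(-1)^{k+1}})$ have a pole at $s=1$. The $\pi_{k,i}$ are unique up to permutation, and we set $ S_\sigma=(\Z / 2 \Z)^{r_n} \times (\Z / 2 \Z)^{r_m}$." [cite: BoisseauLuXue2026FourierJacobiIII, §1.3 (p0004:L60), §1.1.3 (p0004:L21-25)] -/
  BLXbc : Prop
  /-- C303, the same text — the normalising L-value built from BC(σ): p0005:L6 "\cL(s,\sigma)=\prod_{i=1}^n L(i+s-\frac{1}{2},\eta_{E/F}^i)\frac{L(s,\mathrm{BC}(\sigma) \otimes \overline{\mu})}{L(s+\frac{1}{2},\mathrm{BC}(\sigma),\mathrm{As}^{n,m})}," — THEOREM 1.4 (THE SECOND TYPED STATEMENT; the Ichino–Ikeda-type factorisation of |P_{H_W}(φ, ϕ)|² for σ cuspidal on U(V) × U(W) with σ_v tempered at every place, constant |S_σ|⁻¹): p0005:L19 "Theorem 1.4." p0005:L21-23 "Let $\sigma$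 be as above. For every factorizable vectors $\varphi = \otimes_v \varphi_v \in \sigma$ and $\phi=\otimes_v \phi_v \in \nu^\vee$ we have" […] p0005:L26 "|\cP_{\cH_W}(\varphi,\phi)|^2=|S_\sigma|^{-1} \cL(\frac{1}{2},\sigma) \prod_v \cP^\sharp_{\cH_W,v}(\varphi_v,\phi_v)." — proved as Theorem 4.2 of §4.2: p0043:L52 "Let $\sigma$ be an automorphic cuspidal representation of $\cU_W=\U(V) \times \U(W)$ and assume that for all $v$ the local component $\sigma_v$ is tempered. We use the same normalizations and notations as in (subsec:global_II). We need to prove the following." p0043:L54 "Theorem 4.2." p0043:L56-58 "Let $\sigma$ and $\Pi$ be as above. For every factorizable vectors $\varphi = \otimes_v^{'} \varphi_v \in \sigma$ and $\phi=\otimes_v^{'} \phi_v \in \nu^\vee$ we have" […] p0043:L62 "|\cP_{\cH_W}(\varphi,\phi)|^2=|S_\Pi|^{-1} \cL(\frac{1}{2},\sigma) \prod_v \cP^\sharp_{\cH_W,v}(\varphi_v,\phi_v)." [cite: BoisseauLuXue2026FourierJacobiIII, Thm 1.4 (corpus chunks p0005:L19-26; hypothesis p0004:L60) = Thm 4.2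 (p0043:L52-62)] -/
  BLXii : Prop

variable (μ : Mok2015.Nodes) (κ : KMSW2014.Nodes) (c₁₁₇ : Consumers117)

-- Verbatim lines kept out of docstrings by the register's lint (title, section headings and sentences naming a conj.; bibliography keys), `paper-arxiv-2601.01738`:
-- title: p0001:L1 "The global Gan--Gross--Prasad conjecture for Fourier--Jacobi periods on unitary groups III: Proof of the main theorems"
-- §1.1.4, lead sentence: p0004:L29 "The first main result of this paper is the Gan–Gross–Prasad conjecture for cuspidal automorphic representation with generic base-change as stated in [GGP]."
-- §1.3 heading: p0004:L58 "1.3 The global Ichino–Ikeda conjecture"; the third sentence of p0004:L60: p0004:L60 "Note that under the Ramanujan conjecture, the genericity of $\BC(\sigma)$ should be equivalent to the temperedness of the $\sigma_v$'s."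
-- §1.4.3: p0006:L11 "Theorem 1.5." p0006:L13 "Assume that $\Sigma$ is $(\U_V,\U_V',\overline{\mu})$-regular with generic base-change, and let $\lambda \in i \fa_Q^*$. Then the Gan–Gross–Prasad and Ichino–Ikeda conjectures hold for the periods $\cP_{\U_V'}(E(\varphi,\lambda),\phi)$."
-- §5.2 heading: p0031:L45 "5.2 The Ichino–Ikeda conjecture for regular Hermitian Arthur parameters"; §4.2 heading: p0043:L50 "4.2 The Ichino–Ikeda conjecture for Fourier–Jacobi periods"
-- proof of Theorem 4.1, last step of (1) ⇒ (2): p0043:L30 "By the Gan–Gross–Prasad conjecture for $(G,H,\overline{\mu})$-regular Hermitian Arthur parameters from Theorem (thm:ggp_intro), this implies (2)."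
-- proof of Theorem 4.2, the unramified input: p0043:L69 "We take a large enough set of places $\tS$ so that the unramified Ichino–Ikeda conjecture of [Boi]*Theorem 1.0.3.1 holds outside of $\tS$."
-- bibliography keys of the TeX source as rendered in the chunks: p0046:L59 "KMSWarticle" / p0046:L178 "Mokarticle"

/-- C303, THEOREM 1.1 = 4.1: an edge with EMPTY classification premise list, by the authors' sentence following the announcement of the first main result: p0004:L29 "The statement we give is independent of [Mok] and [KMSW] as it only relies on the notion of weak base-change." — and, for the regular-parameter versions (Theorems 1.5 / (thm:ggp_intro) / (thm:II_regular_intro)) from which §4 deduces it: p0006:L15 "We defer to Theorems (thm:ggp_intro) and (thm:II_regular_intro) for precise statements. In fact, the versions we prove do not rely on the existence of $\BC(\sigma)$ and are independent of [Mok] and [KMSW]. As claimed above, this result implies Theorems (thm:GGP) and (thm:II) by unfolding." — the proof of Theorem 4.1 runs through those versions only: p0043:L26 "Note that the $\widetilde{\Pi}_s$ are $(G,H,\overline{\mu})$-regular Hermitian Arthur parameters." (then the `--` comment line above).  The text's inputs (Liu's relative trace formulae compared in parts I / II, the local GGP results [GI2] / [Xue6], [Ram] for the uniqueness of weak base change)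 are published or the authors' own and are declared independent of [Mok] / [KMSW]; as for row C14's Theorem 1.8 (`E_BPLZZggp`), the edge then has no DAG premise at all — this is control E60's reading, kept.  Where [Mok] / [KMSW] WOULD enter THIS statement is said in a remark: p0016:L56 "If we assume the results of [Mok] and [KMSW], then by [Ram], $(G,H,\overline{\mu})$-regular Hermitian Arthur parameters $\Pi$ are exactly the (strong) base-changes of pairs $(Q,\sigma)$ that represent $(\U_V,\U_V',\overline{\mu})$-regular cuspidal data such that $\BC(\sigma_0)$ is generic." — a translation of the hypothesis, not used in the proof.  THE AUTHORS' WORDING: independence declared twice (p0004:L29, p0006:L15). [cite: BoisseauLuXue2026FourierJacobiIII, Thm 1.1 (p0004:L29-37), §1.4.3 (p0006:L15), Remark (p0016:L56), proof of Thm 4.1 (p0043:L18-48)] -/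
def E_BLXggp : Prop := c₁₁₇.BLXggp

/-- C303, THE NODE's SUPPLIER EDGE, in the text's own words (§1.1.3, not a remark): p0004:L21 "There is also a notion of strong base-change. By local Langlands functoriality, for all place $v$ the representation $\sigma_v$ admits a base-change $\mathrm{BC}(\sigma_v)$ which is a smooth irreducible representation of $G_n(F_v) \times G_m(F_v)$. If we assume that all the $\mathrm{BC}(\sigma_v)$ are generic, then by [Mok] and [KMSW], $\mathrm{BC}(\sigma)$ always exists and is a strong base-change, i.e. it satisfies $\mathrm{BC}(\sigma)_v=\mathrm{BC}(\sigma_v)$ for all $v$." and p0004:L23 "In the generic case, for $k \in \{n,m\}$ [Mok] and [KMSW] also tell us that $\BC(\sigma)_k$ can be written as a parabolic induction $\pi_{k,1} \times \hdots \times \pi_{k,r_k}$ where the $\pi_{k,i}$ are cuspidal self-dual automorphic representations of some $G_l$'s, mutually non-isomorphic, and such that the Asai $L$-functions $L(s,\pi_{k,i},\As^{(-1)^{k+1}})$ have a pole at $s=1$. The $\pi_{k,i}$ are unique up to permutation, and we set $ S_\sigma=(\Z / 2 \Z)^{r_n} \times (\Z / 2 \Z)^{r_m}$." — tempered local components have generic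 base change, so for the σ of §1.3 / §4.2 (« so that $\BC(\sigma)$ exists and is generic ») the two classifications are what the text invokes: [Mok] for U(V), U(W) quasi-split, [KMSW] for the other skew-Hermitian spaces (unitary groups of Hermitian spaces, GENERIC parameters — inside KMSW's proved scope `Scope N`, the starred Theorems 1.6.1 / 1.7.1 for generic parameters, the reading of rows C14 / C19 / C26), at the ranks n and m.  Premise: Mok's theorems at every rank and KMSW's proved scope; NOT the book (no symplectic / orthogonal group occurs), NOT KMSW's starred statements beyond the generic case. [cite: BoisseauLuXue2026FourierJacobiIII, §1.1.3 (p0004:L21-23), §1.3 (p0004:L60); Mok2012, Thms 2.5.1, 3.2.1 (as used, by name); KalethaMinguezShinWhite2014, Thms 1.6.1, 1.7.1, generic case (as used, by name)] [claim: KalethaMinguezShinWhite2014, under-review] -/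
def E_BLXbc : Prop := (∀ N, μ.Everything N) → (∀ N, κ.Scope N) → c₁₁₇.BLXbc

/-- C303, THEOREM 1.4 = 4.2 FROM THE NODE — the places: the statement is made under p0004:L60 "We go back to the global setting and let $\sigma$ be a cuspidal automorphic representation of $\cU_W$. We henceforth assume that $\sigma_v$ is tempered at all places $v$ so that $\BC(\sigma)$ exists and is generic." (§1.3) and §4.2 restates it: p0043:L52 "Let $\sigma$ be an automorphic cuspidal representation of $\cU_W=\U(V) \times \U(W)$ and assume that for all $v$ the local component $\sigma_v$ is tempered. We use the same normalizations and notations as in (subsec:global_II). We need to prove the following." with « Let $\sigma$ and $\Pi$ be as above. »; the proof unfolds the period to the text's own regular-parameter Ichino–Ikeda theorem of §5.2, whose hypothesis is p0031:L51 "We assume that $(Q,\sigma)$ admits a weak base-change $\Pi$ which is a $(G,H,\overline{\mu})$-regular Hermitian Arthur parameter." (with p0031:L49 "We write the factorization into local components $\sigma=\otimes'_v \sigma_v$ and assume that all the $\sigma_v$ are tempered. For any $\lambda \in i \fa_Q^*$, set $\Sigma_\lambda=I_Q^{\U_V}\sigma_\lambda$, so that for every $v$ the local component $\Sigma_{\lambda,v}$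 is tempered.") — for the cuspidal σ of Theorem 4.2 that weak base change Π is the BC(σ) of the node — and uses the L-function identity p0043:L71 "We have the equality of $L$-functions $ L^{\tS}(1,\sigma_V,\mathrm{Ad})L^{\tS}(1,\sigma_W,\mathrm{Ad})=L^{\tS}(1,\Pi,\mathrm{As}^{n,m})$. Therefore, we want to prove that", read off BC(σ) = Π likewise.  The other inputs — the regular-parameter theorems (thm:ggp_intro) / (thm:II_regular_intro) of this text with parts I / II (declared independent of [Mok] / [KMSW], p0006:L15 "We defer to Theorems (thm:ggp_intro) and (thm:II_regular_intro) for precise statements. In fact, the versions we prove do not rely on the existence of $\BC(\sigma)$ and are independent of [Mok] and [KMSW]. As claimed above, this result implies Theorems (thm:GGP) and (thm:II) by unfolding."), [Boi] (the unramified computation, `--` comment above), [FLO12] / [CS80] (Whittaker periods on general linear groups), the local tempered computations of §3 — are the authors' own or published and classification-free (absorbed).  TWO READINGS DISPLAYED (bookkeeping below): with the node as an explicit hypothesis the theorem consumes no leaf (`blxIi_of_node`); with the node supplied as the text supplies it (`E_BLXbc`) it inherits Mok's leaves and KMSW's proved-scope leaves (`blxIi_of_inputs`) — the structure of row C14 (Theorem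 1.8 vs 1.10) and of row C26, which control E60's census note names without typing.  THE AUTHORS' WORDING: none on this dependence beyond the two « by [Mok] and [KMSW] » / « [Mok] and [KMSW] also tell us » sentences; the independence sentences are stated for Theorem 1.1 and for the regular-parameter versions, not for Theorem 1.4 (recorded, not flagged). [cite: BoisseauLuXue2026FourierJacobiIII, Thm 1.4 (p0005:L19-26), §1.3 (p0004:L60), §4.2 (p0043:L52-71), §5.2.1 (p0031:L49-51), §1.4.3 (p0006:L15)] -/
def E_BLXii : Prop := c₁₁₇.BLXbc → c₁₁₇.BLXii

/-- The hundred-and-seventeenth tranche of implications (C303: one premise-free edge, the node's supplier edge from Mok ∧ KMSW's proved scope, the theorem from the node). [cite: BoisseauLuXue2026FourierJacobiIII, Thms 1.1, 1.4, §1.1.3 (edges as printed)] [claim: KalethaMinguezShinWhite2014, under-review] -/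
structure Implications117 : Prop where
  blxGgp : E_BLXggp c₁₁₇
  blxbc : E_BLXbc μ κ c₁₁₇
  blxIi : E_BLXii c₁₁₇

variable {μ κ c₁₁₇}

/-- C303, THEOREM 1.1 inherits NOTHING from the three DAGs — the weak-base-change formulation, « independent of [Mok] and [KMSW] » by the authors' sentence (control E60's reading). [cite: BoisseauLuXue2026FourierJacobiIII, Thm 1.1 (p0004:L29-37) (bookkeeping proved here)] -/
theorem blxGgp_inherits_nothing (Y : Implications117 μ κ c₁₁₇) : c₁₁₇.BLXggp := Y.blxGgp

/-- C303, THEOREM 1.4 AS STATED FROM THE NODE ALONE: with §1.3's standing hypothesis granted as a hypothesis, no leaf of any DAG is consumed (first reading). [cite: BoisseauLuXue2026FourierJacobiIII, Thm 1.4 (p0005:L19-26) (bookkeeping proved here)] -/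
theorem blxIi_of_node (Y : Implications117 μ κ c₁₁₇) (h : c₁₁₇.BLXbc) : c₁₁₇.BLXii := Y.blxIi h

/-- C303, THE NODE FROM MOK's INPUTS AND KMSW's PROVED-SCOPE INPUTS (the Mok import edge included), per the text's supplier sentence — NOT KMSW's sequels, NOT the book. [cite: BoisseauLuXue2026FourierJacobiIII, §1.1.3 (p0004:L21-23) (bookkeeping proved here)] [claim: KalethaMinguezShinWhite2014, under-review] -/
theorem blxbc_of_inputs (Y : Implications117 μ κ c₁₁₇) (M : MokInputs μ) (K : KMSWInputs μ κ) : c₁₁₇.BLXbc :=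
  Y.blxbc M.everything (K.scope M)

/-- C303, THEOREM 1.4 WITH THE SUPPLIER EDGE (second reading): it inherits every leaf of Mok's memoir and KMSW's proved-scope leaves — NOT the sequels, NOT the book. [cite: BoisseauLuXue2026FourierJacobiIII, Thm 1.4 (bookkeeping proved here)] [claim: KalethaMinguezShinWhite2014, under-review] -/
theorem blxIi_of_inputs (Y : Implications117 μ κ c₁₁₇) (M : MokInputs μ) (K : KMSWInputs μ κ) : c₁₁₇.BLXii :=
  blxIi_of_node Y (blxbc_of_inputs Y M K)

/-- C303, THEOREM 1.4 IN CONDITIONAL FORM, 2026 (a PREPRINT Ichino–Ikeda-type formula stated for σ tempered everywhere « so that $\BC(\sigma)$ exists and is generic »): granting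
Mok's section derivations and supply edges, KMSW's chapter derivations, supply edges and the Mok import edge, and every PUBLISHED input of both, Theorem 1.4 with the supplier
edge is conditional on Mok's 2024–2026 preprint layer, on the two unwritten weighted fundamental lemmas as Mok's memoir consumes them, and on the general weighted
fundamental lemma as KMSW's proved scope consumes it — exactly the residue of rows C14 (Theorem 1.10) and C26. [cite: BoisseauLuXue2026FourierJacobiIII, Thm 1.4 (p0005:L19-26), p0004:L21-23 (bookkeeping proved here)] [claim: KalethaMinguezShinWhite2014, under-review] -/
theorem blxIi_conditional_form (Y : Implications117 μ κ c₁₁₇) (MB : μ.SectionEdges) (MS : μ.SupplyEdges) (MP : μ.PublishedLeaves) (D1 : KMSW2014.E_ImportMok μ κ)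
    (KB : κ.ChapterEdges) (KS : κ.SupplyEdges) (KP : κ.PublishedLeaves) :
    μ.PreprintLeaves2026 → μ.WFL_general → μ.WFL_nonstandard → κ.WFL_general → c₁₁₇.BLXii :=
  fun hQ h6 h7 k6 => blxIi_of_inputs Y ⟨MB, MS, MP, hQ, ⟨h6, h7⟩⟩ ⟨D1, KB, KS, KP, ⟨k6⟩⟩

/-- THE WHOLE HUNDRED-AND-SEVENTEENTH TRANCHE FROM THE INPUTS OF MOK's AND KMSW's DAGs — nothing of the book's DAG. [cite: BoisseauLuXue2026FourierJacobiIII, Thms 1.1, 1.4 (bookkeeping proved here)] [claim: KalethaMinguezShinWhite2014, under-review] -/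
theorem hundredseventeenth_of_inputs (Y : Implications117 μ κ c₁₁₇) (M : MokInputs μ) (K : KMSWInputs μ κ) : c₁₁₇.BLXggp ∧ c₁₁₇.BLXbc ∧ c₁₁₇.BLXii :=
  ⟨blxGgp_inherits_nothing Y, blxbc_of_inputs Y M K, blxIi_of_inputs Y M K⟩

end Downstream

end Literature.NumberTheory.Automorphic.Arthur2013
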